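import Summits.BirchSwinnertonDyer.BirchSwinnertonDyer.Theorems.Rank1ResidualX1Defs
import Literature.NumberTheory.EllipticCurves.Rank1Residual.X10RankZeroIntegralMainConjecture
import Literature.NumberTheory.EllipticCurves.Rank1Residual.X10MainConjecture
import Literature.NumberTheory.EllipticCurves.Wuthrich2014.RankOneConverseOddPrimeProofs

/-!
# Rank-≤1 BSD residual class X10b (`p = 3` good ordinary, `E[3]` irreducible, small image): BOTH ranks are ONE Mazur main conjecture at `(E, 3)` away — the rank-one half modulo the Schneider certificate

HONEST FRAMING (cell `b2b-bsdres`, home `run/shared/lean/b2b/bsd-rank1-residual/`, unit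
`b2b-bsdres-x10`, X10 prover, gen 6). The goal of the cell is to DELETE the COMBINATION-SHAPED
residual classes for ALL analytic-rank `≤ 1` curves over `ℚ` — "full BSD formula for every rank `≤ 1`
curve in class C" assembled STRICTLY from published theorems — so that the rank-`≤ 1` remainder becomes
exactly the CONSTRUCTION-SHAPED classes, which are TYPED (missing-input `Prop`s), NOT attempted; this
is not "finishing BSD". Helper file of the crux `PAdicOrderMainConjectureR5`
(stmt-BirchSwinnertonDyer-15418); companion of `Rank1ResidualX10MainConjecture` (gen 5, X10a′ ∩ {r = 0})
and of the Literature files `Rank1Residual/X10RankZeroIntegralMainConjecture` (rank `0`, either image)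
and `Wuthrich2014/RankOneConverseOddPrimeProofs` (the odd-prime rank-one engine of unit x1b).

**What this file records (X10-AUDIT.md §12, referee ruling R77.3 asked for the rank-one half).**
X10 := `p = 3 ∧ GoodOrd W 3 ∧ Irr W 3 ∧ ((r = 0 ∧ ¬Ram W 3) ∨ (r = 1 ∧ ¬Semistable W))`
(`Rank1Residual.ClassX10`); X10b := X10 ∧ ¬surj(3) (mod-`3` image a Cartan normaliser `3Ns`/`3Nn`,
of order prime to `3`, so (Im) and (ram) fail structurally — `ClassX10.not_bigIm_of_not_surj`).
In prover A's vocabulary (`MazurMainConjecture W 3` = Mazur's cyclotomic main conjecture at `(E,3)` in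
the Néron normalisation, `Rank1ResidualX1Defs`):

* rank `0`, EITHER image: `MazurMainConjecture W 3 → BSDp W 3`
  (`X10.bsdp_three_rankZero_of_mazurMainConjecture`; inputs Greenberg LNM 1716 Thm. 4.1, modularity
  with an integral Manin constant, Gross–Zagier–Kolyvagin — all PUBLISHED named facts; NO period-unit
  hypothesis, since prover A's conjecture is already Néron-normalised) — the kernel form of
  `X10.bsdp_three_rankZero_of_integralMainConjecture` (p193890, f-normalised + `hϖ`);
* rank `1`, EITHER image: `MazurMainConjecture W 3 → BSDp W 3` MODULO the Schneider certificate `hSch`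
  (non-degeneracy of THE canonical cyclotomic `3`-adic height — Schneider 1985, open class-wide,
  certified pair by pair by `[T¹]L₃(E,T) ≠ 0`, i.e. `Reg₃(E) ≠ 0`)
  (`X10.bsdp_three_rankOne_of_mazurMainConjecture`; inputs Perrin-Riou–Schneider = BMS 2016 Thm. 1.7 at
  `p > 2`, Perrin-Riou 1987 §1.4 at odd `p`, Mazur–Tate / MST 2006 sigma at odd `p`, modularity, GZK —
  PUBLISHED; the deduction is unit x1b's `Wuthrich2014.missingPPartAt_of_mainConjecture_of_rank_one_odd`,
  which carries NO hypothesis on the image of `ρ̄_{E,3}`);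
* both ranks in the cell's canonical shape (`X10.bsdp_three_of_mazurMainConjecture`) and as a
  DISCHARGE of the Literature-side typing `Typed.X10.MissingInputAt W`
  (`X10.missingInputAt_of_mazurMainConjecture`);
* rank `1`, the Euler-system HALF alone: an integral Kato-direction divisibility at `(E,3)`
  (`char_Λ X ∣ ϖ·L₃(f,α)`, hypothesis `hdiv` — on X10a′ this is Kato Thm. 17.4 (3) via Wuthrich
  Lemma 20, on X10b it is NOT in print: Kato 13.4 (3) needs a rank-one-cokernel element) gives, modulo
  `hSch`, the typed upper half `MissingUpperBoundAt W 3` (`X10.missingUpperBoundAt_three_rankOne_of_divisibility`)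
  and, at a pair with `ord₃ #Ш(E/ℚ)_an = 0`, Miller's `BSD(E,3)`
  (`X10.bsdp_three_rankOne_of_divisibility_of_shaAn_unit`); on X10a′ the divisibility is discharged
  (`X10.bsdp_three_rankOne_surj_of_schneider_of_shaAn_unit`: `Surj W 3` + Kato + Lemma 20 + the
  period unit `hϖ` + ONE computed hypothesis `hSch` + the census datum `ord₃ #Ш_an = 0` — one computed
  hypothesis fewer than gen 4's `X10.bsdp_three_of_kato_of_leadingTerm_certificate`, because
  Perrin-Riou's `3`-adic Gross–Zagier theorem turns the valuation identity `hcert` into a consequence).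

So, in the kernel, the X10b row of RESIDUAL-CASES.md §a.2 (both ranks) is CONSTRUCTION-SHAPED with ONE
typed missing input — Mazur's integral cyclotomic main conjecture at a good ordinary `3` whose mod-`3`
image is a Cartan normaliser ("[BS24]" announced for `p ≥ 5`, not out; Yan–Zhu 2026 Thm. 4.9 prints it
only under (Im)) — plus, on the rank-one half, the per-pair `3`-adic height certificate. The
anticyclotomic routes (JSW 2017, W. Zhang 2014, BCGS 2026, Howard 2004, Wan 2021, BSTW Thm. 1.9
announced) all carry (sur)/(Im)/(ram)/square-free `N`/`p ≥ 5` and do not shorten this (X10-AUDIT.md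
§12.1). Nothing here is a class theorem of the cell or changes a label; per pair the X10b census is
closed by certificates (two-engine exact `3`-descent, unit x10b; Cha's Heegner index) independently.

References: [PerrinRiou1987] §1.4 Cor. 1.8; [BalakrishnanMullerStein2015] Thm. 1.7;
[MazurSteinTate2006] Thm. 1.3; [Balakrishnan2016] §2; [GreenbergLNM1716] Thm. 4.1; [CastellaEtAl2021]
Thm. 5.1.4; [Kato2004Asterisque] Thm. 17.4 (3), Thm. 13.4 (3); [Wuthrich2014] Lemma 20, Prop. 21;
[CastellaGrossiSkinner2025] Introduction (MC); [Miller2011LMS] Def. 1.1; cell file X10-AUDIT.md §11–§12.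
-/

noncomputable section

open scoped Classical MatrixGroups ModularForm

open CongruenceSubgroup WeierstrassCurve Literature.NumberTheory.EllipticCurves
  Literature.NumberTheory.EllipticCurves.ModularForms Literature.NumberTheory.EllipticCurves.Rank1Residual
  Literature.NumberTheory.EllipticCurves.Rank1Residual.Typed
  Literature.NumberTheory.EllipticCurves.Wuthrich2014
  Summit.BirchSwinnertonDyer.BirchSwinnertonDyer.Theorems.Rank1ResidualX1Defs

set_option linter.dupNamespace false
set_option autoImplicit false

namespace Summit.BirchSwinnertonDyer.BirchSwinnertonDyer.Theorems.Rank1ResidualX10bMainConjecture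

variable (W : WeierstrassCurve ℚ) [W.IsElliptic] [W.IsGloballyMinimal]

/-! ### Rank zero, either image -/

/-- **X10 ∩ {r = 0}, EITHER mod-`3` image: Mazur's main conjecture at `(E,3)` ⟹ Miller's `BSD(E,3)`.**
For `W/ℚ` globally minimal elliptic with `ClassX10 W 3` and `ord_{s=1} L(E,s) = 0`, granted the
PUBLISHED named facts Greenberg LNM 1716 Thm. 4.1 (`hGr`), modularity with an integral Manin constant
(`hmod`) and Gross–Zagier–Kolyvagin (`hGZK`): `MazurMainConjecture W 3 → BSDp W 3`. Proof: prover A's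
conjecture is the Néron-normalised main conjecture, which is exactly the hypothesis of
`padicValRat_bsd_rank_zero_of_mazurMainConjecture` (Castella–Grossi–Lee–Skinner 2022, proof of
Thm. 5.1.4, as glue); then `bsdp_of_padicValRat_rank_zero`. On X10a′ the hypothesis is Yan–Zhu 2026
Thm. 4.9 (PUB\*, flag `YZ26@3-BF-ERL-Ohta`); on X10b it is the typed missing object.
[cite: CastellaEtAl2021, Thm. 5.1.4 and its proof (§5.1.3)] [cite: GreenbergLNM1716, Thm. 4.1 (p. 102)]
[cite: Miller2011LMS, Def. 1.1 (arXiv:1010.2431 p. 3)] -/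
theorem X10.bsdp_three_rankZero_of_mazurMainConjecture (hGr : greenberg_charValue_rankZero)
    (hmod : nonempty_modularParametrizationData)
    (hGZK : rank_eq_analyticRank_of_analyticRank_le_one)
    (hX : ClassX10 W 3) (hr0 : W.analyticRank = 0) (hMC : MazurMainConjecture W 3) : BSDp W 3 := by
  haveI : NeZero (W.conductorNorm ℤ) := ⟨(W.conductorNorm_pos_holds).ne'⟩
  obtain ⟨Dm⟩ := hmod W
  have hL : W.entireLFunction 1 ≠ 0 :=
    (W.analyticRank_eq_zero_iff_holds Dm.isNewformOf.hasEntireLFunction).mp hr0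
  have hfin : Finite W.sha := (hGZK W (by rw [hr0]; exact zero_le_one)).2
  exact bsdp_of_padicValRat_rank_zero W 3 hr0 hL hGZK
    (padicValRat_bsd_rank_zero_of_mazurMainConjecture W 3 hX.2.1.1 hX.2.1.2 hL hfin hmod
      (hGr W 3 (by decide) hX.2.1.1 hX.2.1.2) hMC)

/-! ### Rank one, either image, modulo the Schneider certificate -/

/-- **X10 ∩ {r = 1}, EITHER mod-`3` image: Mazur's main conjecture at `(E,3)` ⟹ Miller's `BSD(E,3)`,
modulo the Schneider certificate.** For `W/ℚ` globally minimal elliptic with `ClassX10 W 3` and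
`ord_{s=1} L(E,s) = 1`, granted the PUBLISHED named facts Perrin-Riou–Schneider at odd `p` (`hS`, BMS
2016 Thm. 1.7), Perrin-Riou 1987 §1.4 at odd `p` (`hPR`), the Mazur–Tate sigma function at odd `p`
(`hMT`), modularity (`hmod`) and Gross–Zagier–Kolyvagin (`hGZK`), and the per-pair certificate `hSch`
(Schneider's non-degeneracy of THE canonical cyclotomic `3`-adic height; ⟺ `[T¹]L₃(E,T) ≠ 0`):
`MazurMainConjecture W 3 → BSDp W 3`. One-line instance of unit x1b's
`Wuthrich2014.missingPPartAt_of_mainConjecture_of_rank_one_odd` (no hypothesis on the image of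
`ρ̄_{E,3}`) and `Typed.bsdp_of_missingPPartAt`. [cite: PerrinRiou1987, §1.4 Cor. 1.8]
[cite: BalakrishnanMullerStein2015, Thm. 1.7] [cite: Balakrishnan2016, §2]
[cite: Miller2011LMS, Def. 1.1 (arXiv:1010.2431 p. 3)] -/
theorem X10.bsdp_three_rankOne_of_mazurMainConjecture (hS : Schneider1985_order_charGenerator_odd)
    (hPR : perrinRiou_rankOne_leadingTerms_odd) (hMT : mazur_tate_sigma_exists_odd)
    (hmod : nonempty_modularParametrizationData)
    (hGZK : rank_eq_analyticRank_of_analyticRank_le_one)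
    (hX : ClassX10 W 3) (hr1 : W.analyticRank = 1)
    (hSch : ∀ Dh : PAdicHeightData W 3, Dh.IsCanonical → SchneiderConjecture Dh)
    (hMC : MazurMainConjecture W 3) : BSDp W 3 :=
  bsdp_of_missingPPartAt W 3 hGZK hr1.le
    (missingPPartAt_of_mainConjecture_of_rank_one_odd hS hPR hMT hmod hGZK W 3 (by decide)
      hX.2.1.1 hX.2.1.2 hr1 hSch hMC)

/-! ### Both ranks: the X10b row is ONE main conjecture away (rank one modulo the certificate) -/

/-- **X10, EITHER image, both ranks: Mazur's main conjecture at `(E,3)` ⟹ Miller's `BSD(E,3)`** — at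
rank `1` modulo the Schneider certificate (`hSch`, only invoked when `ord_{s=1} L(E,s) = 1`). Facts as in
the two theorems above. This is the kernel form of the statement "the X10b row of RESIDUAL-CASES.md
§a.2 is CONSTRUCTION-SHAPED with ONE typed missing input, the integral cyclotomic main conjecture at a
good ordinary `3` with Cartan-normaliser image" (X10-AUDIT.md §12). [cite: PerrinRiou1987, §1.4 Cor. 1.8]
[cite: BalakrishnanMullerStein2015, Thm. 1.7] [cite: CastellaEtAl2021, Thm. 5.1.4 and its proof (§5.1.3)]
[cite: Miller2011LMS, Def. 1.1 (arXiv:1010.2431 p. 3)] -/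
theorem X10.bsdp_three_of_mazurMainConjecture (hS : Schneider1985_order_charGenerator_odd)
    (hPR : perrinRiou_rankOne_leadingTerms_odd) (hMT : mazur_tate_sigma_exists_odd)
    (hGr : greenberg_charValue_rankZero) (hmod : nonempty_modularParametrizationData)
    (hGZK : rank_eq_analyticRank_of_analyticRank_le_one)
    (hX : ClassX10 W 3)
    (hSch : W.analyticRank = 1 → ∀ Dh : PAdicHeightData W 3, Dh.IsCanonical → SchneiderConjecture Dh)
    (hMC : MazurMainConjecture W 3) : BSDp W 3 := by
  rcases hX.2.2.2 with ⟨hr0, -⟩ | ⟨hr1, -⟩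
  · exact X10.bsdp_three_rankZero_of_mazurMainConjecture W hGr hmod hGZK hX hr0 hMC
  · exact X10.bsdp_three_rankOne_of_mazurMainConjecture W hS hPR hMT hmod hGZK hX hr1 (hSch hr1) hMC

/-- **Hence the Literature-side typing `Typed.X10.MissingInputAt W` (`¬Surj W 3 → MissingPPartAt W 3`)
is DISCHARGED on all of X10 by Mazur's main conjecture at `(E,3)`** (rank one modulo the Schneider
certificate): the OUTPUT typing in Miller's currency and the OBJECT typing (an integral main conjecture
for a small irreducible image at `3`) agree in BOTH ranks, as for X9 (referee R9.4) and as p193890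
recorded at rank `0`. Bookkeeping. [cite: PerrinRiou1987, §1.4 Cor. 1.8]
[cite: CastellaEtAl2021, Thm. 5.1.4 and its proof (§5.1.3)] [cite: Miller2011LMS, Def. 1.1] -/
theorem X10.missingInputAt_of_mazurMainConjecture (hS : Schneider1985_order_charGenerator_odd)
    (hPR : perrinRiou_rankOne_leadingTerms_odd) (hMT : mazur_tate_sigma_exists_odd)
    (hGr : greenberg_charValue_rankZero) (hmod : nonempty_modularParametrizationData)
    (hGZK : rank_eq_analyticRank_of_analyticRank_le_one)
    (hX : ClassX10 W 3)
    (hSch : W.analyticRank = 1 → ∀ Dh : PAdicHeightData W 3, Dh.IsCanonical → SchneiderConjecture Dh)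
    (hMC : MazurMainConjecture W 3) : Typed.X10.MissingInputAt W := by
  haveI : Finite W.sha := (hGZK W (ClassX10.analyticRank_le_one hX)).2
  exact Typed.X10.missingInputAt_of_bsdp W
    (X10.bsdp_three_of_mazurMainConjecture W hS hPR hMT hGr hmod hGZK hX hSch hMC)

/-! ### Rank one: the Euler-system half from an integral divisibility alone -/

/-- **X10 ∩ {r = 1}, EITHER image: an integral Kato-direction divisibility at `(E,3)` ⟹ the typed
UPPER half `ord₃ #Ш(E/ℚ) ≤ ord₃ #Ш(E/ℚ)_an`, modulo the Schneider certificate.** The hypothesis `hdiv`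
is the shape "for the cyclotomic `(κ, γ)`, the newform `f` of `E` at level `N_E`, the period ratio `ϖ`
(`ϖ · Ω_E = Ω⁺_f`) and every Pontryagin-dual datum `D`: `X` is `Λ`-torsion and some `g ∈ char_Λ X` has
`ι g = ϖ · L₃(f, α)`" — on X10a′ the conclusion of Kato Thm. 17.4 (3) via Wuthrich Lemma 20 (see
`X10.bsdp_three_rankOne_surj_of_schneider_of_shaAn_unit`), on X10b NOT in print (Kato Thm. 13.4 (3)
needs an element of `Gal(ℚ̄/ℚ(μ_{3^∞}))` with rank-one cokernel, impossible for an image of order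
prime to `3`). The defect is `ord₃ h(0) ≥ 0` for the cofactor `h` of unit x1b's engine
`exists_cofactor_of_mem_charIdeal_of_rank_one_odd` (Perrin-Riou–Schneider `hS`, Perrin-Riou 1987
`hPR`, GZK `hGZK`; the canonical height datum from `hMT`, the newform from `hmod`).
[cite: PerrinRiou1987, §1.4 Cor. 1.8] [cite: BalakrishnanMullerStein2015, Thm. 1.7]
[cite: Kato2004Asterisque, Thm. 13.4 (3) (p. 246) and Thm. 17.4 (3) (p. 273)]
[cite: Miller2011LMS, Def. 1.1 (arXiv:1010.2431 p. 3)] -/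
theorem X10.missingUpperBoundAt_three_rankOne_of_divisibility
    (hS : Schneider1985_order_charGenerator_odd) (hPR : perrinRiou_rankOne_leadingTerms_odd)
    (hMT : mazur_tate_sigma_exists_odd) (hmod : nonempty_modularParametrizationData)
    (hGZK : rank_eq_analyticRank_of_analyticRank_le_one)
    (hX : ClassX10 W 3) (hr1 : W.analyticRank = 1)
    (hSch : ∀ Dh : PAdicHeightData W 3, Dh.IsCanonical → SchneiderConjecture Dh)
    (hdiv : ∀ (κ : ZpExtension ℚ 3) (γ : Field.absoluteGaloisGroup ℚ),
        κ.IsCyclotomic → κ.IsTopGenerator γ → IsCyclotomicVariable 3 γ →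
      ∀ [NeZero (W.conductorNorm ℤ)] (f : CuspForm (Gamma0 (W.conductorNorm ℤ)) 2),
        IsNewformOf W f → ∀ (ϖ : ℚ), (ϖ : ℝ) * W.realPeriodRat = plusPeriod f →
      ∀ (D : W.SelmerDualData κ γ), D.IsTorsion ∧
        ∃ g ∈ D.charIdeal, iwasawaToPowerSeries 3 g =
          PowerSeries.C (ϖ : ℚ_[3]) * padicLFunction f (unitRoot W 3 : ℚ_[3])) :
    MissingUpperBoundAt W 3 := by
  obtain ⟨κ, hκ, γ, hγ, hγ'⟩ := exists_isCyclotomic_isTopGenerator_isCyclotomicVariable_holds 3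
  obtain ⟨D⟩ := W.nonempty_selmerDualData_holds κ γ hγ
  haveI : NeZero (W.conductorNorm ℤ) := ⟨(W.conductorNorm_pos_holds).ne'⟩
  obtain ⟨Dm⟩ := hmod W
  obtain ⟨ϖ, -, hϖ, -⟩ := Dm.exists_rat_mul_realPeriodRat_eq_plusPeriod
  obtain ⟨Dh, hDh, -⟩ := existsUnique_isCanonical_of_odd hMT W 3 (by decide) hX.2.1.1 hX.2.1.2
  obtain ⟨hXt, g, hgmem, hιg⟩ := hdiv κ γ hκ hγ hγ' Dm.f Dm.isNewformOf ϖ hϖ D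
  obtain ⟨fE, h, s, -, -, -, -, hsha, -, hval⟩ := exists_cofactor_of_mem_charIdeal_of_rank_one_odd
    hS hPR hGZK W 3 (by decide) hX.2.1.1 hX.2.1.2 hr1 hκ hγ hγ' Dm.isNewformOf ϖ hϖ Dh hDh
    (hSch Dh hDh) D hXt g hgmem hιg
  refine ⟨s, hsha, ?_⟩
  have h0 : 0 ≤ (((PowerSeries.constantCoeff h : ℤ_[3]) : ℚ_[3])).valuation :=
    PadicInt.valuation_coe_nonneg
  rw [hval]
  linarith

/-- **X10 ∩ {r = 1}, EITHER image, at a pair with `ord₃ #Ш(E/ℚ)_an = 0`: the integral divisibility and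
the Schneider certificate give Miller's `BSD(E,3)`** — the lower half is vacuous when the analytic order
of `Ш` is a `3`-adic unit (`hunit`, census datum), the upper half is
`X10.missingUpperBoundAt_three_rankOne_of_divisibility`. Per pair; on X10b `hdiv` is the typed missing
input (the census pairs are closed independently by the exact `3`-descent of unit x10b).
[cite: PerrinRiou1987, §1.4 Cor. 1.8] [cite: BalakrishnanMullerStein2015, Thm. 1.7]
[cite: Miller2011LMS, Def. 1.1 (arXiv:1010.2431 p. 3)] -/
theorem X10.bsdp_three_rankOne_of_divisibility_of_shaAn_unit
    (hS : Schneider1985_order_charGenerator_odd) (hPR : perrinRiou_rankOne_leadingTerms_odd)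
    (hMT : mazur_tate_sigma_exists_odd) (hmod : nonempty_modularParametrizationData)
    (hGZK : rank_eq_analyticRank_of_analyticRank_le_one)
    (hX : ClassX10 W 3) (hr1 : W.analyticRank = 1)
    (hSch : ∀ Dh : PAdicHeightData W 3, Dh.IsCanonical → SchneiderConjecture Dh)
    (hdiv : ∀ (κ : ZpExtension ℚ 3) (γ : Field.absoluteGaloisGroup ℚ),
        κ.IsCyclotomic → κ.IsTopGenerator γ → IsCyclotomicVariable 3 γ →
      ∀ [NeZero (W.conductorNorm ℤ)] (f : CuspForm (Gamma0 (W.conductorNorm ℤ)) 2),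
        IsNewformOf W f → ∀ (ϖ : ℚ), (ϖ : ℝ) * W.realPeriodRat = plusPeriod f →
      ∀ (D : W.SelmerDualData κ γ), D.IsTorsion ∧
        ∃ g ∈ D.charIdeal, iwasawaToPowerSeries 3 g =
          PowerSeries.C (ϖ : ℚ_[3]) * padicLFunction f (unitRoot W 3 : ℚ_[3]))
    (hunit : ∃ q : ℚ, shaAn W = (q : ℂ) ∧ padicValRat 3 q = 0) : BSDp W 3 := by
  refine bsdp_of_missingPPartAt W 3 hGZK hr1.le (missingPPartAt_of_lower_of_upper W 3 ?_
    (X10.missingUpperBoundAt_three_rankOne_of_divisibility W hS hPR hMT hmod hGZK hX hr1 hSch hdiv))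
  obtain ⟨q, hq, hv⟩ := hunit
  exact ⟨q, hq, by rw [hv]; exact_mod_cast Nat.zero_le _⟩

/-- **X10a′ ∩ {r = 1} (surjective mod-`3` image): the divisibility IS Kato's theorem, so the Schneider
certificate and `ord₃ #Ш(E/ℚ)_an = 0` alone give Miller's `BSD(E,3)`.** Inputs: Kato Thm. 17.4 (3) for
the newform at level `N_E` and every cyclotomic datum (`hK`, named fact `kato_divisibility`, integral
clause under `3`-adic surjectivity), Wuthrich 2014 Lemma 20 (`hW20`: at a good `3`, mod-`3` surjective
⟹ `3`-adically surjective), the period unit `hϖ` (inline, as in gen 5's `Rank1ResidualX10MainConjecture`: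
`ord₃ ϖ = 0` for `ϖ · Ω_E = Ω⁺_f` — irreducible good `3`, Mazur / `3 ∤` Manin constant), and the facts of
`X10.bsdp_three_rankOne_of_divisibility_of_shaAn_unit`. Compared with gen 4's
`X10.bsdp_three_of_kato_of_leadingTerm_certificate` (p184219) this needs ONE computed hypothesis
(`hSch` ⟺ `ord_{T=0} L₃(f,α) = 1`) instead of two (`hord`, `hcert`): Perrin-Riou's `3`-adic
Gross–Zagier theorem (`hPR`) makes the valuation identity `hcert` a consequence. Per pair (the
certificate); the CLASS X10a′ ∩ {r = 1} is Yan–Zhu 2026 Thm. 4.15 (PUB\*).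
[cite: Kato2004Asterisque, Thm. 17.4 (3) (p. 273)] [cite: Wuthrich2014, Lemma 20 (p. 400)]
[cite: PerrinRiou1987, §1.4 Cor. 1.8] [cite: BalakrishnanMullerStein2015, Thm. 1.7]
[cite: Miller2011LMS, Def. 1.1 (arXiv:1010.2431 p. 3)] -/
theorem X10.bsdp_three_rankOne_surj_of_schneider_of_shaAn_unit
    (hS : Schneider1985_order_charGenerator_odd) (hPR : perrinRiou_rankOne_leadingTerms_odd)
    (hMT : mazur_tate_sigma_exists_odd) (hmod : nonempty_modularParametrizationData)
    (hGZK : rank_eq_analyticRank_of_analyticRank_le_one)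
    (hW20 : lemma20_surjective_threeAdic_of_semistable)
    (hK : ∀ (κ : ZpExtension ℚ 3) (γ : Field.absoluteGaloisGroup ℚ) [NeZero (W.conductorNorm ℤ)]
      (f : CuspForm (Gamma0 (W.conductorNorm ℤ)) 2), kato_divisibility W 3 (κ := κ) (γ := γ) (f := f))
    (hϖ : ∀ [NeZero (W.conductorNorm ℤ)] (f : CuspForm (Gamma0 (W.conductorNorm ℤ)) 2),
      IsNewformOf W f → ∀ ϖ : ℚ, (ϖ : ℝ) * W.realPeriodRat = plusPeriod f → padicValRat 3 ϖ = 0)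
    (hX : ClassX10 W 3) (hsurj : Surj W 3) (hr1 : W.analyticRank = 1)
    (hSch : ∀ Dh : PAdicHeightData W 3, Dh.IsCanonical → SchneiderConjecture Dh)
    (hunit : ∃ q : ℚ, shaAn W = (q : ℂ) ∧ padicValRat 3 q = 0) : BSDp W 3 := by
  refine X10.bsdp_three_rankOne_of_divisibility_of_shaAn_unit W hS hPR hMT hmod hGZK hX hr1 hSch ?_ hunit
  intro κ γ hκ hγ hγ' _ f hf ϖ hϖeq D
  have hsurjpow := Rank1Residual.X10.surjective_pow_three_of_surj W hW20 hX hsurj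
  have hplus : plusPeriod f ≠ 0 := (IsNewform0.plusPeriod_pos_holds hf.1 hf.coeffField_eq_bot).ne'
  have hϖ0 : ϖ ≠ 0 := by
    rintro rfl
    apply hplus
    rw [← hϖeq]
    simp
  exact divisibility_of_kato_of_surjective_pow W 3 (hK κ γ f) (by decide) hX.2.1.1 hX.2.1.2 hsurjpow
    hκ hγ hγ' hf D ϖ hϖ0 (hϖ f hf ϖ hϖeq)

end Summit.BirchSwinnertonDyer.BirchSwinnertonDyer.Theorems.Rank1ResidualX10bMainConjecture

end
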